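import Summits.HodgeConjecture.HodgeConjecture.Theorems.Ring2TransportWeilDivisorialAnchors
import Literature.AlgebraicGeometry.HodgeTheory.HodgeClassesIsogenyInvariance
import Literature.AlgebraicGeometry.HodgeTheory.WeilClassesHodgeType
import Literature.AlgebraicGeometry.HodgeTheory.WeilClassesIsogenyDescent
import Literature.AlgebraicGeometry.HodgeTheory.WeilClassesSquareDivisorPolynomial
import Literature.AlgebraicGeometry.HodgeTheory.WeilClassesMoonenZarhinCriterionHolds
import Literature.AlgebraicGeometry.HodgeTheory.DivisorClassesHardLefschetz
import Literature.AlgebraicGeometry.Motives.AbelianVarietyCohomologyExteriorH1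
import HarnessLib

/-!
# Ring 2 transport (gen 14) — Weil classes of varieties `K`-isogenous to a diagonal power `C^m` of a
`K`-rank-2 balanced pair are DIVISORIAL; the diagonal-pointed leaf `Sup_Δ`

Research route conditional on `HC_CM`; not a corollary; Q11.4-sentence-2 already refuted in dim ≥ 3.
(`HC_CM` := `Theses.RankFourFaces.CMAbelianHodge`, item `stmt-HodgeConjecture-3052`, is a HYPOTHESIS wherever it
occurs; nothing here proves it.)  Helper file `--supports stmt-HodgeConjecture-16267`; items 16267/16268 NOT re-filed.

Gen 13 (`Ring2TransportWeilDivisorialAnchors`) based rows R3 / R3-local / R3-germ / T6-CM on the leaf `Sup_Wdiv :=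
WeilDivisorialCMPointedWeilFamiliesCMField` and kernel-checked node (N1) (`W_K ⊆ D¹` on a `K`-rank-2 balanced pair),
leaving node (N2) — divisoriality of `W_K` on the DIAGONAL member of Deligne's family — in print.  This file proves
(N2) in its natural generality and re-bases the rows on it:

* `weilClassesField_le_divisorClassesSpan_of_projections` (**Lemma N2**, sorry-free): `(X, φ)` with `P(φ) = 0`,
  `e·2m = 2 dim X`; `(C, ψ)` a `K`-rank-2 balanced pair (`P(ψ) = 0`, `e·2 = 2 dim C`, `n_ρ = n_ρ̄`); if `X` admits
  `m` `K`-equivariant maps `π_i : X → C` jointly injective on `H¹(C)^m → H¹(X)` (i.e. `X` is `K`-isogenous to the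
  diagonal power `C^m`: Deligne's member `E₀^m ⊗ K = (E₀ ⊗ K)^m`, or `B_Φ^m × B_Φ̄^m`), then
  `W_K(X) ⊗ ℂ ⊆ D^m(X) ⊗ ℂ` (hence `⊆ Alg^m`, `divisorClassesSpan_le_algebraicClasses_dim`).  Proof without Künneth
  or product varieties: for a root `ρ` the `2m` classes `π_i^* b_j` (`b₀, b₁` a basis of `V_ρ(C) ⊂ H¹(C)`) are
  linearly independent `ρ`-eigenvectors, so `Ω_ρ := ⌣ π_i^* b_j ≠ 0` spans the Weil LINE `L_ρ(X) = ⋀^{2m} V_ρ(X)`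
  (`exists_generator_pullbackEigenclasses_of_root`, `cupPowOne_ne_zero_of_linearIndependent`), while
  `Ω_ρ = ∏_i π_i^*(b₀ ⌣ b₁) ∈ D^m(X)` because `b₀ ⌣ b₁ ∈ L_ρ(C) ⊆ D¹(C)` by (N1).
* `DiagonalCMPointedWeilFamiliesCMField` (**leaf `Sup_Δ`**, `@[conjecture]`, OPEN here, print-known): gen 13's leaf
  with its anchor clause replaced by the STRUCTURAL one "the fibre at `s₀` carries a CM Weil-type chart `(A₀, φ₀)`
  with `m` equivariant maps to a `K`-rank-2 balanced pair, jointly injective on `H¹`";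
  `weilDivisorialCMPointed_of_diagonalCMPointed : Sup_Δ → Sup_Wdiv` is Lemma N2.  Print remainder = node (N3) only:
  Deligne's connected family through `(A, K, θ)` [1982, proof of Thm. 4.8; built without its hypothesis (b)] ∋, by
  Landherr, `(B_Φ × B_Φ̄)^m` polarised in the class of `θ` [§5 (c)] — EVERY class; `E₀^m ⊗ K` = split class only.
* Rows (one-liners over gen 13): `HC_WeilClassesCMField_of_diagonalCMPointed[_local, _of_semiregularChernLift]`,
  `HC_GeneralWeilTypeCMField_of_diagonalCMPointed_closed[_local]` (fact #24 =
  `Deligne1982_hodgeRing_weilTypeCM_of_hodgeGroupSU`, UNREFEREED ×2, binder only),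
  `HC_CM_of_andre_of_diagonalCMPointed_of_variational` (`HC_CM` as CONCLUSION from open inputs); audit
  `diagonalAnchors_position`.  OPEN and NOT proved here: `Sup_Δ`, `R3var := WeilVariationalHodgeCMField`,
  `LocalWeilVHCAtCMField`, `SemiregularChernLiftAtCMField` (Grothendieck's VHC in Weil families), fact #24.
  Inputs of NO theorem: [arXiv:2502.03415], [doi:10.1137/25m1803796], [arXiv:2509.23079], Perry [arXiv:2604.00511]
  (UNREFEREED).  Print status of Lemma N2: folklore ([Deligne 1982, Rem. 4.10]; [van Geemen 1994, §5.3]).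

[cite: Deligne1982HodgeCycles, §4, Thm. 4.8 (proof), Rem. 4.9, Rem. 4.10, Prop. 4.4, Lemma 4.5]
[cite: MoonenZarhin1998WeilClasses, §1] [cite: vanGeemen1994HodgeAV, §2.4, §5.3, Thm. 6.12] [cite: Andre1992HodgeCM, Théorème]
-/

set_option linter.dupNamespace false

noncomputable section

open CategoryTheory

namespace Summit.HodgeConjecture.HodgeConjecture.Ring2Transport

open Literature.AlgebraicGeometry Literature.AlgebraicGeometry.Motives
open Literature.AlgebraicGeometry.HodgeTheory
open Literature.AlgebraicGeometry.Deligne1982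
open Literature.AlgebraicTopology.SingularHomology
open Literature.AlgebraicGeometry.Milne1999 (IsOfCMType)
open Literature.Barriers.HodgeConjecture (divisorClassesSpan divisorMonomials mem_divisorMonomials_zero
  mem_divisorMonomials_succ)
open Summit.HodgeConjecture.HodgeConjecture.WeilTypeLadder
open Summit.HodgeConjecture.HodgeConjecture.Theses

/-! ### §0 Toolkit: divisor monomials, pull-backs, the interleaved index -/

section Toolkit

/-- `Dᵐ ⌣ D¹ ⊆ D^{m+1}` (complex spans of divisor monomials; the right factor ranges over the SPAN `D¹ ⊗ ℂ`).
[folklore] -/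
theorem cupProduct_mem_divisorClassesSpan_succ_of_mem_one {X : SchemeOver ℂ} {N m : ℕ}
    (h : 2 * m + 2 * 1 = 2 * (m + 1)) {a : complexBetti X (2 * m)} (ha : a ∈ divisorClassesSpan X N m)
    {b : complexBetti X (2 * 1)} (hb : b ∈ divisorClassesSpan X N 1) :
    cupProduct h a b ∈ divisorClassesSpan X N (m + 1) := by
  have hb' : b ∈ Submodule.span ℂ {b : complexBetti X 2 | IsRationalClass b ∧ IsOfHodgeType N X 2 1 1 b} := by
    refine (Submodule.span_le.2 ?_) hb
    intro c hc
    obtain ⟨a', ha', b', hb'Q, hb'H, rfl⟩ := mem_divisorMonomials_succ.1 hc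
    rw [mem_divisorMonomials_zero] at ha'
    subst ha'
    have h1 : cupProduct (show 2 * 0 + 2 = 2 * (0 + 1) by ring) (singularCohomology.one ℂ _) b' = b' :=
      one_cupProduct b'
    rw [h1]
    exact Submodule.subset_span ⟨hb'Q, hb'H⟩
  exact cupProduct_mem_divisorClassesSpan_succ h ha hb'

variable {A B C : AbelianVariety ℂ}

/-- `f^*(g^* c) = (f ≫ g)^* c` on `H^k`, in `complexBetti.map` form. [folklore] -/
theorem complexBetti_map_map_apply {k : ℕ} (f : A ⟶ B) (g : B ⟶ C) (c : complexBetti C.X k) :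
    complexBetti.map f.hom.hom.hom k (complexBetti.map g.hom.hom.hom k c) =
      complexBetti.map (f ≫ g).hom.hom.hom k c :=
  abelianVarietyHom_map_map_apply f g c

/-- The interleaving bijection `Fin (2m) ≃ Fin m × Fin 2`, `k ↦ (k / 2, k % 2)`. -/
def pairIndex (m : ℕ) : Fin (2 * m) ≃ Fin m × Fin (2 * 1) :=
  (finCongr (by omega : 2 * m = m * (2 * 1))).trans finProdFinEquiv.symm

/-- First component of `pairIndex`: `k / 2`. -/
@[simp] theorem pairIndex_fst_val (m : ℕ) (k : Fin (2 * m)) : (((pairIndex m) k).1 : ℕ) = (k : ℕ) / 2 := by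
  simp [pairIndex]

/-- Second component of `pairIndex`: `k % 2`. -/
@[simp] theorem pairIndex_snd_val (m : ℕ) (k : Fin (2 * m)) : (((pairIndex m) k).2 : ℕ) = (k : ℕ) % 2 := by
  simp [pairIndex]

/-- `pairIndex` on the first `2m` of `2(m+1)` indices. -/
theorem pairIndex_cast_castAdd (m : ℕ) (h : 2 * m + 2 * 1 = 2 * (m + 1)) (i : Fin (2 * m)) :
    pairIndex (m + 1) (Fin.cast h (Fin.castAdd (2 * 1) i)) = (Fin.castSucc (pairIndex m i).1, (pairIndex m i).2) := by
  refine Prod.ext (Fin.ext ?_) (Fin.ext ?_)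
  · simp only [pairIndex_fst_val, Fin.val_cast, Fin.val_castAdd, Fin.val_castSucc]
  · simp only [pairIndex_snd_val, Fin.val_cast, Fin.val_castAdd]

/-- `pairIndex` on the last two of `2(m+1)` indices. -/
theorem pairIndex_cast_natAdd (m : ℕ) (h : 2 * m + 2 * 1 = 2 * (m + 1)) (j : Fin (2 * 1)) :
    pairIndex (m + 1) (Fin.cast h (Fin.natAdd (2 * m) j)) = (Fin.last m, j) := by
  have hj := j.isLt
  refine Prod.ext (Fin.ext ?_) (Fin.ext ?_)
  · simp only [pairIndex_fst_val, Fin.val_cast, Fin.val_natAdd, Fin.val_last]; omega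
  · simp only [pairIndex_snd_val, Fin.val_cast, Fin.val_natAdd]; omega

/-- The interleaved pulled-back family `(π₀^* b₀, π₀^* b₁, π₁^* b₀, π₁^* b₁, …)` in `H¹(X)`. -/
def pairPull {m : ℕ} (π : Fin m → (A ⟶ C)) (b : Fin (2 * 1) → complexBetti C.X 1) (k : Fin (2 * m)) :
    complexBetti A.X 1 :=
  complexBetti.map (π (pairIndex m k).1).hom.hom.hom 1 (b (pairIndex m k).2)

/-- The first `2m` members of the interleaved family for `m+1` maps are the family of the first `m` maps. -/
theorem pairPull_cast_castAdd {m : ℕ} (π : Fin (m + 1) → (A ⟶ C)) (b : Fin (2 * 1) → complexBetti C.X 1)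
    (h : 2 * m + 2 * 1 = 2 * (m + 1)) (i : Fin (2 * m)) :
    pairPull π b (Fin.cast h (Fin.castAdd (2 * 1) i)) = pairPull (fun i => π (Fin.castSucc i)) b i := by
  simp only [pairPull, pairIndex_cast_castAdd]

/-- The last two members of the interleaved family are `π_m^* b₀, π_m^* b₁`. -/
theorem pairPull_cast_natAdd {m : ℕ} (π : Fin (m + 1) → (A ⟶ C)) (b : Fin (2 * 1) → complexBetti C.X 1)
    (h : 2 * m + 2 * 1 = 2 * (m + 1)) (j : Fin (2 * 1)) :
    pairPull π b (Fin.cast h (Fin.natAdd (2 * m) j)) = complexBetti.map (π (Fin.last m)).hom.hom.hom 1 (b j) := by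
  simp only [pairPull, pairIndex_cast_natAdd]

/-- The interleaved family consists of `ρ`-eigenvectors of `φ^*` when the `b_j` are `ρ`-eigenvectors of `ψ^*`
and the `π_i` are equivariant. [folklore] -/
theorem pairPull_mem_eigenspace {m : ℕ} {φ : A ⟶ A} {ψ : C ⟶ C} {π : Fin m → (A ⟶ C)}
    (hπ : ∀ i, π i ≫ ψ = φ ≫ π i) {ρ : ℂ} {b : Fin (2 * 1) → complexBetti C.X 1}
    (hb : ∀ j, b j ∈ Module.End.eigenspace (complexBetti.map ψ.hom.hom.hom 1).hom ρ) (k : Fin (2 * m)) :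
    pairPull π b k ∈ Module.End.eigenspace (complexBetti.map φ.hom.hom.hom 1).hom ρ := by
  rw [Module.End.mem_eigenspace_iff]
  have hj := Module.End.mem_eigenspace_iff.1 (hb (pairIndex m k).2)
  change complexBetti.map φ.hom.hom.hom 1
      (complexBetti.map (π (pairIndex m k).1).hom.hom.hom 1 (b (pairIndex m k).2)) =
    ρ • complexBetti.map (π (pairIndex m k).1).hom.hom.hom 1 (b (pairIndex m k).2)
  rw [complexBetti_map_map_apply, ← hπ, ← complexBetti_map_map_apply]
  change complexBetti.map (π (pairIndex m k).1).hom.hom.hom 1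
      ((complexBetti.map ψ.hom.hom.hom 1).hom (b (pairIndex m k).2)) = _
  rw [hj, map_smul]

/-- Joint injectivity of `(y_i) ↦ ∑ π_i^* y_i` on `H¹` and linear independence of `b` give linear independence of
the interleaved family. [folklore] -/
theorem linearIndependent_pairPull {m : ℕ} {π : Fin m → (A ⟶ C)}
    (hinj : ∀ y : Fin m → complexBetti C.X 1,
      (∑ i, complexBetti.map (π i).hom.hom.hom 1 (y i)) = 0 → ∀ i, y i = 0)
    {b : Fin (2 * 1) → complexBetti C.X 1} (hb : LinearIndependent ℂ b) :
    LinearIndependent ℂ (pairPull π b) := by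
  classical
  rw [Fintype.linearIndependent_iff] at hb ⊢
  intro c hc k
  have hsum : (∑ i : Fin m, complexBetti.map (π i).hom.hom.hom 1
      (∑ j : Fin (2 * 1), c ((pairIndex m).symm (i, j)) • b j)) = 0 := by
    rw [← hc, ← (pairIndex m).symm.sum_comp (fun k => c k • pairPull π b k), Fintype.sum_prod_type]
    refine Finset.sum_congr rfl fun i _ => ?_
    rw [map_sum]
    refine Finset.sum_congr rfl fun j _ => ?_
    rw [map_smul]
    simp only [pairPull, Equiv.apply_symm_apply]
  have hk := hb (fun j => c ((pairIndex m).symm ((pairIndex m k).1, j)))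
    (hinj (fun i => ∑ j : Fin (2 * 1), c ((pairIndex m).symm (i, j)) • b j) hsum (pairIndex m k).1)
    (pairIndex m k).2
  simpa only [Prod.mk.eta, Equiv.symm_apply_apply] using hk

/-- `⌣_k (interleaved family) ∈ D^m(X)` as soon as `b₀ ⌣ b₁ ∈ D¹(C)`: it is `∏_i π_i^*(b₀ ⌣ b₁)`. [folklore] -/
theorem cupPowOne_pairPull_mem_divisorClassesSpan (b : Fin (2 * 1) → complexBetti C.X 1)
    (hbD : cupPowOne ℂ (ComplexPoints C.X) (2 * 1) b ∈ divisorClassesSpan C.X C.dim 1)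
    (m : ℕ) (π : Fin m → (A ⟶ C)) :
    cupPowOne ℂ (ComplexPoints A.X) (2 * m) (pairPull π b) ∈ divisorClassesSpan A.X A.dim m := by
  induction m with
  | zero => exact mem_divisorClassesSpan_zero (AbelianVariety.isSmoothProjective_holds (A := A)) _
  | succ m ih =>
    have h : 2 * m + 2 * 1 = 2 * (m + 1) := by ring
    rw [cupPowOne_eq_cupProduct_split ℂ (2 * m) (2 * 1) h (pairPull π b)]
    simp only [pairPull_cast_castAdd, pairPull_cast_natAdd]
    refine cupProduct_mem_divisorClassesSpan_succ_of_mem_one h (ih (fun i => π (Fin.castSucc i))) ?_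
    rw [← complexBetti_map_cupPowOne]
    exact AbelianVariety.map_mem_divisorClassesSpan (π (Fin.last m)) hbD

end Toolkit

/-! ### §1 Lemma N2: Weil classes of varieties `K`-isogenous to `C^m` are divisorial -/

section LemmaN2

variable {X C : AbelianVariety ℂ}

/-- **A Weil line meeting `S` non-trivially lies in `S`.**  For a root `ρ` of `P` (`P(φ) = 0`, `e·r = 2 dim X`)
`L_ρ(X, r)` is a LINE (`exists_generator_pullbackEigenclasses_of_root`); if `r` linearly independent `ρ`-eigenvectors
`w_i ∈ H¹(X)` have `⌣_i w_i ∈ S` then `L_ρ(X, r) ⊆ S`. [cite: MoonenZarhin1998WeilClasses, §1] -/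
theorem pullbackEigenclasses_le_of_cupPowOne_mem {φ : X ⟶ X} {P : Polynomial ℤ} {e r : ℕ}
    (hPm : P.Monic) (hPe : P.natDegree = e) (hPirr : Irreducible (P.map (Int.castRingHom ℚ)))
    (hφ : Polynomial.eval₂ (Int.castRingHom (End X)) (φ : End X) P = 0) (her : e * r = 2 * X.dim)
    {ρ : ℂ} (hρ : Polynomial.eval₂ (Int.castRingHom ℂ) ρ P = 0)
    {w : Fin r → complexBetti X.X 1} (hw : LinearIndependent ℂ w)
    (hwρ : ∀ i, w i ∈ Module.End.eigenspace (complexBetti.map φ.hom.hom.hom 1).hom ρ)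
    {S : Submodule ℂ (complexBetti X.X r)} (hS : cupPowOne ℂ (ComplexPoints X.X) r w ∈ S) :
    pullbackEigenclasses X φ r (fun x y => ((x : ℂ) + (y : ℂ) * ρ) ^ r) ≤ S := by
  obtain ⟨ω, -, -, -, hgen⟩ := exists_generator_pullbackEigenclasses_of_root hPm hPe hPirr hφ her hρ
  have hΩ0 : cupPowOne ℂ (ComplexPoints X.X) r w ≠ 0 := cupPowOne_ne_zero_of_linearIndependent X hw
  obtain ⟨t₀, ht₀⟩ := hgen _ (cupPowOne_mem_pullbackEigenclasses_pow φ hwρ)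
  have ht₀0 : t₀ ≠ 0 := by rintro rfl; exact hΩ0 (by rw [ht₀, zero_smul])
  intro c hc
  obtain ⟨t, ht⟩ := hgen c hc
  have hc' : c = (t * t₀⁻¹) • cupPowOne ℂ (ComplexPoints X.X) r w := by
    rw [ht₀, smul_smul, mul_assoc, inv_mul_cancel₀ ht₀0, mul_one, ht]
  rw [hc']
  exact S.smul_mem _ hS

/-- **Lemma N2 (Weil classes of varieties `K`-isogenous to a diagonal power of a rank-2 balanced pair are
divisorial).**  `(X, φ)` with `P(φ) = 0`, `e·2m = 2 dim X`; `(C, ψ)` a `K`-rank-2 balanced pair (`P(ψ) = 0`,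
`e·2 = 2 dim C`, `n_ρ = n_ρ̄`); `π_i : X → C` (`i < m`) equivariant and jointly injective on `H¹`.  Then
`W_K(X) ⊗ ℂ ⊆ D^m(X) ⊗ ℂ` (and hence `⊆ Alg^m(X)` by `divisorClassesSpan_le_algebraicClasses_dim`).  Covers Deligne's
member `A₀ ⊗_ℚ K`, `A₀ = E₀^m` (`X = (E₀ ⊗ K)^m`, `C = E₀ ⊗ K ≅ E₀^e`) and `X = B_Φ^m × B_Φ̄^m` (`C = B_Φ × B_Φ̄`).
[cite: Deligne1982HodgeCycles, §4, proof of Thm. 4.8, Rem. 4.9–4.10] [cite: vanGeemen1994HodgeAV, §5.3] -/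
theorem weilClassesField_le_divisorClassesSpan_of_projections {φ : X ⟶ X} {ψ : C ⟶ C}
    {P : Polynomial ℤ} {e m : ℕ} (hPm : P.Monic) (hPe : P.natDegree = e)
    (hPirr : Irreducible (P.map (Int.castRingHom ℚ)))
    (hφ : Polynomial.eval₂ (Int.castRingHom (End X)) (φ : End X) P = 0) (hX : e * (2 * m) = 2 * X.dim)
    (hψ : Polynomial.eval₂ (Int.castRingHom (End C)) (ψ : End C) P = 0) (hC : e * (2 * 1) = 2 * C.dim)
    (hbal : ∀ ρ : ℂ, Polynomial.eval₂ (Int.castRingHom ℂ) ρ P = 0 →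
      eigenMultiplicity C ψ ρ = eigenMultiplicity C ψ (starRingEnd ℂ ρ))
    (π : Fin m → (X ⟶ C)) (hπ : ∀ i, π i ≫ ψ = φ ≫ π i)
    (hinj : ∀ y : Fin m → complexBetti C.X 1,
      (∑ i, complexBetti.map (π i).hom.hom.hom 1 (y i)) = 0 → ∀ i, y i = 0) :
    weilClassesField X φ P (2 * m) ≤ divisorClassesSpan X.X X.dim m := by
  unfold weilClassesField
  refine iSup₂_le fun ρ hρ => ?_
  haveI := finite_complexBetti_abelianVariety C 1
  let V : Submodule ℂ (complexBetti C.X 1) := Module.End.eigenspace (complexBetti.map ψ.hom.hom.hom 1).hom ρ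
  have hV : Module.finrank ℂ V = 2 * 1 := finrank_eigenspace_eq_of_root hPm hPe hPirr hψ hC hρ
  let β := Module.finBasisOfFinrankEq ℂ V hV
  let b : Fin (2 * 1) → complexBetti C.X 1 := fun j => (β j : complexBetti C.X 1)
  have hb_mem : ∀ j, b j ∈ Module.End.eigenspace (complexBetti.map ψ.hom.hom.hom 1).hom ρ := fun j => (β j).2
  have hb_li : LinearIndependent ℂ b := β.linearIndependent.map' V.subtype (Submodule.ker_subtype V)
  have hbD : cupPowOne ℂ (ComplexPoints C.X) (2 * 1) b ∈ divisorClassesSpan C.X C.dim 1 :=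
    weilClassesField_two_le_divisorClassesSpan hPm hPe hPirr hψ hC hbal
      (pullbackEigenclasses_le_weilClassesField hρ (cupPowOne_mem_pullbackEigenclasses_pow ψ hb_mem))
  exact pullbackEigenclasses_le_of_cupPowOne_mem hPm hPe hPirr hφ hX hρ
    (linearIndependent_pairPull hinj hb_li) (pairPull_mem_eigenspace hπ hb_mem)
    (cupPowOne_pairPull_mem_divisorClassesSpan b hbD m π)

end LemmaN2

/-! ### §2 The diagonal-pointed leaves and the re-based rows -/

/-- **Leaf `Sup_Δ`: Weil families through every Weil-type `(A, K)` with a CM fibre `K`-isogenous to a diagonal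
power of a `K`-rank-2 balanced pair.**  Verbatim the quantifier prefix and family clauses of
`WeilDivisorialCMPointedWeilFamiliesCMField` (gen 13) / `AnchoredWeilFamiliesCMField` (gen 1); the anchor clause is
replaced by: the fibre at `s₀` carries a Weil-type chart `(A₀, φ₀, e₀)` of CM type reading `W|s₀` as a Weil class, a
`K`-rank-2 balanced pair `(C₀, ψ₀)` and `m` equivariant maps `π_i : A₀ → C₀` jointly injective on `H¹`.  Print = node
(N3), OPEN here: Deligne's connected family through `(A, K, θ)` [proof of Thm. 4.8; built without hypothesis (b)]
contains, by Landherr's theorem (1936), `(B_Φ × B_Φ̄)^m` polarised by `⊕ f_i θ_i` in the discriminant class of `θ`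
[§5 (c)] — in EVERY class; `E₀^m ⊗ K` with the product polarisation only in the SPLIT class (ref1 F68).  (The CM
conjunct serves the LOCAL rows, not N2.) [cite: Deligne1982HodgeCycles, §4, Thm. 4.8 (proof), Prop. 4.4, §5 (c)] -/
@[conjecture] def DiagonalCMPointedWeilFamiliesCMField : Prop :=
  ∀ (A : Motives.AbelianVariety ℂ) (φ : A ⟶ A) (P : Polynomial ℤ) (e m : ℕ),
    P.Monic → P.natDegree = e → 2 < e → Irreducible (P.map (Int.castRingHom ℚ)) →
    Polynomial.eval₂ (Int.castRingHom (CategoryTheory.End A)) (φ : CategoryTheory.End A) P = 0 →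
    e * (2 * m) = 2 * A.dim →
    (∀ ρ : ℂ, Polynomial.eval₂ (Int.castRingHom ℂ) ρ P = 0 → starRingEnd ℂ ρ ≠ ρ) →
    (∃ Q : Polynomial ℚ, ∀ ρ : ℂ, Polynomial.eval₂ (Int.castRingHom ℂ) ρ P = 0 →
        Polynomial.eval₂ (algebraMap ℚ ℂ) ρ Q = starRingEnd ℂ ρ) →
      ∀ c ∈ weilClassesField A φ P (2 * m), IsRationalClass c →
        IsOfHodgeType A.dim A.X (2 * m) m m c → c ≠ 0 →
        ∃ (𝒳 S : Motives.SchemeOver ℂ) (f : 𝒳 ⟶ S) (s₁ s₀ : Motives.ComplexPoints S)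
            (ι : A.X ≅ Motives.fiberOver f s₁) (W : complexBetti 𝒳 (2 * m)),
          Motives.IsSmoothProjectiveFamily f (e * m) ∧ IsQuasiProjectiveOver 𝒳 ∧ IsQuasiProjectiveOver S ∧
          IrreducibleSpace S.left ∧ AlgebraicGeometry.Smooth S.hom ∧
          (∀ s : Motives.ComplexPoints S,
            IsRationalClass (complexBetti.map (Motives.fiberι f s) (2 * m) W) ∧
              IsOfHodgeType (e * m) (Motives.fiberOver f s) (2 * m) m m
                (complexBetti.map (Motives.fiberι f s) (2 * m) W)) ∧
          (∀ s : Motives.ComplexPoints S, ∃ (A' : Motives.AbelianVariety ℂ) (φ' : A' ⟶ A')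
              (e' : A'.X ≅ Motives.fiberOver f s),
            Polynomial.eval₂ (Int.castRingHom (CategoryTheory.End A')) (φ' : CategoryTheory.End A') P = 0 ∧
              e * (2 * m) = 2 * A'.dim ∧
              complexBetti.map e'.hom (2 * m) (complexBetti.map (Motives.fiberι f s) (2 * m) W) ∈
                weilClassesField A' φ' P (2 * m)) ∧
          complexBetti.map ι.hom (2 * m) (complexBetti.map (Motives.fiberι f s₁) (2 * m) W) = c ∧
          ∃ (A₀ : Motives.AbelianVariety ℂ) (φ₀ : A₀ ⟶ A₀) (e₀ : A₀.X ≅ Motives.fiberOver f s₀)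
              (C₀ : Motives.AbelianVariety ℂ) (ψ₀ : C₀ ⟶ C₀) (π : Fin m → (A₀ ⟶ C₀)),
            A₀.dim = e * m ∧ IsOfCMType A₀ ∧
            Polynomial.eval₂ (Int.castRingHom (CategoryTheory.End A₀)) (φ₀ : CategoryTheory.End A₀) P = 0 ∧
            complexBetti.map e₀.hom (2 * m) (complexBetti.map (Motives.fiberι f s₀) (2 * m) W) ∈
              weilClassesField A₀ φ₀ P (2 * m) ∧
            Polynomial.eval₂ (Int.castRingHom (CategoryTheory.End C₀)) (ψ₀ : CategoryTheory.End C₀) P = 0 ∧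
            e * (2 * 1) = 2 * C₀.dim ∧
            (∀ ρ : ℂ, Polynomial.eval₂ (Int.castRingHom ℂ) ρ P = 0 →
              eigenMultiplicity C₀ ψ₀ ρ = eigenMultiplicity C₀ ψ₀ (starRingEnd ℂ ρ)) ∧
            (∀ i, π i ≫ ψ₀ = φ₀ ≫ π i) ∧
            (∀ y : Fin m → complexBetti C₀.X 1,
              (∑ i, complexBetti.map (π i).hom.hom.hom 1 (y i)) = 0 → ∀ i, y i = 0)

/-- **`Sup_Δ → Sup_Wdiv`** (gen 13's Weil-divisorial leaf) — this is Lemma N2 at the diagonal fibre.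
[cite: Deligne1982HodgeCycles, Rem. 4.10] -/
theorem weilDivisorialCMPointed_of_diagonalCMPointed (hP : DiagonalCMPointedWeilFamiliesCMField) :
    WeilDivisorialCMPointedWeilFamiliesCMField := by
  intro A φ P e m hPm hPe he hirr hφ hdim hnr hQ c hc hcQ hcH hc0
  obtain ⟨𝒳, S, f, s₁, s₀, ι, W, hf, h𝒳, hS, hirrS, hsm, hW, hWeil, hread, A₀, φ₀, e₀, C₀, ψ₀, π, hA₀dim, hA₀cm,
      hφ₀, hx, hψ₀, hC₀, hbal, hπ, hinj⟩ := hP A φ P e m hPm hPe he hirr hφ hdim hnr hQ c hc hcQ hcH hc0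
  have hA₀ : e * (2 * m) = 2 * A₀.dim := by rw [hA₀dim]; ring
  exact ⟨𝒳, S, f, s₁, s₀, ι, W, hf, h𝒳, hS, hirrS, hsm, hW, hWeil, hread, A₀, e₀, hA₀dim, hA₀cm,
    weilClassesField_le_divisorClassesSpan_of_projections hPm hPe hirr hφ₀ hA₀ hψ₀ hC₀ hbal π hπ hinj hx⟩

/-! #### Rows re-based on `Sup_Δ` (every other hypothesis exactly as in gen 13) -/

/-- Row **R3 on `Sup_Δ`**: `Sup_Δ ∧ R3var ⟹ R3`. [cite: Deligne1982HodgeCycles, §4–5] -/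
theorem HC_WeilClassesCMField_of_diagonalCMPointed (hP : DiagonalCMPointedWeilFamiliesCMField)
    (hV : WeilVariationalHodgeCMField) : WeilClassesCMField :=
  HC_WeilClassesCMField_of_weilDivisorialCMPointed (weilDivisorialCMPointed_of_diagonalCMPointed hP) hV

/-- Row **R3-local on Sup_Δ**: with the LOCAL VHC germ at the CM diagonal fibre. -/
theorem HC_WeilClassesCMField_of_diagonalCMPointed_local (hP : DiagonalCMPointedWeilFamiliesCMField)
    (hL : LocalWeilVHCAtCMField) : WeilClassesCMField :=
  HC_WeilClassesCMField_of_weilDivisorialCMPointed_local (weilDivisorialCMPointed_of_diagonalCMPointed hP) hL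

/-- Row **R3-germ on Sup_Δ**: with the semiregular Chern lift + Buchweitz–Flenner. [cite: BuchweitzFlenner2003] -/
theorem HC_WeilClassesCMField_of_diagonalCMPointed_of_semiregularChernLift (Ch : ChernCharacterBetti)
    (hP : DiagonalCMPointedWeilFamiliesCMField) (hL : SemiregularChernLiftAtCMField Ch)
    (hBF : BuchweitzFlenner2003_variationalHodge_ISemiregular) : WeilClassesCMField :=
  HC_WeilClassesCMField_of_weilDivisorialCMPointed_of_semiregularChernLift Ch
    (weilDivisorialCMPointed_of_diagonalCMPointed hP) hL hBF

/-- Row **T6-CM (closed) on Sup_Δ**: general Weil type over a CM field, fact #24 as a BINDER (UNREFEREED ×2).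
[cite: Deligne1982HodgeCycles, §5] -/
theorem HC_GeneralWeilTypeCMField_of_diagonalCMPointed_closed
    (h24 : Deligne1982_hodgeRing_weilTypeCM_of_hodgeGroupSU) (hP : DiagonalCMPointedWeilFamiliesCMField)
    (hV : WeilVariationalHodgeCMField) : HodgeGeneralWeilTypeCMField :=
  HC_GeneralWeilTypeCMField_of_weilDivisorialCMPointed_closed h24 (weilDivisorialCMPointed_of_diagonalCMPointed hP) hV

/-- Row **T6-CM (closed, local) on Sup_Δ**. -/
theorem HC_GeneralWeilTypeCMField_of_diagonalCMPointed_local_closed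
    (h24 : Deligne1982_hodgeRing_weilTypeCM_of_hodgeGroupSU) (hP : DiagonalCMPointedWeilFamiliesCMField)
    (hL : LocalWeilVHCAtCMField) : HodgeGeneralWeilTypeCMField :=
  HC_GeneralWeilTypeCMField_of_weilDivisorialCMPointed_local_closed h24
    (weilDivisorialCMPointed_of_diagonalCMPointed hP) hL

/-- Row **HC_CM from André + the quadratic rungs + (Sup_Δ, R3var)** — `HC_CM` is the CONCLUSION here, from OPEN
print inputs; it is not proved. [cite: Andre1992HodgeCM, Théorème] -/
theorem HC_CM_of_andre_of_diagonalCMPointed_of_variational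
    (hA : Andre1992_hodgeClasses_cmAbelianVariety_mem_span_pullback_weilClasses)
    (hP₂ : DivisorGeneratedCMPointedWeilFamiliesQuadratic) (hV₂ : WeilVariationalHodgeQuadratic)
    (hP₃ : DiagonalCMPointedWeilFamiliesCMField) (hV₃ : WeilVariationalHodgeCMField) :
    Theses.RankFourFaces.CMAbelianHodge :=
  HC_CM_of_andre_of_weilDivisorialCMPointed_of_variational hA hP₂ hV₂
    (weilDivisorialCMPointed_of_diagonalCMPointed hP₃) hV₃

/-! ### §3 Audit -/

/-- **Position of gen 14 (audit conjunction).** (1) Lemma N2 (proved); (2) `Sup_Δ → Sup_Wdiv` (proved);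
(3)–(4) rows R3 / R3-local on `Sup_Δ` (proved implications; their hypotheses `Sup_Δ`, `R3var`,
`LocalWeilVHCAtCMField` are OPEN and NOT proved here); (5) `HC_CM` appears only as the conclusion of row
`HC_CM_of_andre_…` from open inputs.  Research route conditional on `HC_CM`; not a corollary; Q11.4-sentence-2
already refuted in dim ≥ 3. -/
theorem diagonalAnchors_position :
    (∀ {X C : AbelianVariety ℂ} {φ : X ⟶ X} {ψ : C ⟶ C} {P : Polynomial ℤ} {e m : ℕ},
      P.Monic → P.natDegree = e → Irreducible (P.map (Int.castRingHom ℚ)) →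
      Polynomial.eval₂ (Int.castRingHom (End X)) (φ : End X) P = 0 → e * (2 * m) = 2 * X.dim →
      Polynomial.eval₂ (Int.castRingHom (End C)) (ψ : End C) P = 0 → e * (2 * 1) = 2 * C.dim →
      (∀ ρ : ℂ, Polynomial.eval₂ (Int.castRingHom ℂ) ρ P = 0 →
        eigenMultiplicity C ψ ρ = eigenMultiplicity C ψ (starRingEnd ℂ ρ)) →
      ∀ (π : Fin m → (X ⟶ C)), (∀ i, π i ≫ ψ = φ ≫ π i) →
        (∀ y : Fin m → complexBetti C.X 1,
          (∑ i, complexBetti.map (π i).hom.hom.hom 1 (y i)) = 0 → ∀ i, y i = 0) →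
        weilClassesField X φ P (2 * m) ≤ divisorClassesSpan X.X X.dim m) ∧
    (DiagonalCMPointedWeilFamiliesCMField → WeilDivisorialCMPointedWeilFamiliesCMField) ∧
    (DiagonalCMPointedWeilFamiliesCMField → WeilVariationalHodgeCMField → WeilClassesCMField) ∧
    (DiagonalCMPointedWeilFamiliesCMField → LocalWeilVHCAtCMField → WeilClassesCMField) ∧
    (Andre1992_hodgeClasses_cmAbelianVariety_mem_span_pullback_weilClasses →
      DivisorGeneratedCMPointedWeilFamiliesQuadratic → WeilVariationalHodgeQuadratic →
      DiagonalCMPointedWeilFamiliesCMField → WeilVariationalHodgeCMField → Theses.RankFourFaces.CMAbelianHodge) :=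
  ⟨fun hPm hPe hPirr hφ hX hψ hC hbal π hπ hinj =>
      weilClassesField_le_divisorClassesSpan_of_projections hPm hPe hPirr hφ hX hψ hC hbal π hπ hinj,
    weilDivisorialCMPointed_of_diagonalCMPointed,
    HC_WeilClassesCMField_of_diagonalCMPointed, HC_WeilClassesCMField_of_diagonalCMPointed_local,
    HC_CM_of_andre_of_diagonalCMPointed_of_variational⟩

end Summit.HodgeConjecture.HodgeConjecture.Ring2Transport

end
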